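import Summits.NavierStokesRegularity.NavierStokesRegularity.Theorems.RecurrentProfilesRecurrentReductionOrbit
import Summits.NavierStokesRegularity.NavierStokesRegularity.Theorems.SymmetryModuliCountForcedSymmetryRdssLiouvilleTauReduction
import Summits.NavierStokesRegularity.NavierStokesRegularity.Theorems.SymmetryModuliCountForcedSymmetryStubSatelliteExclusionTools
import Literature.Analysis.FluidPDE.ClassicalSolution
import Literature.Analysis.FluidPDE.LocalTypeI
import Literature.Analysis.FluidPDE.SelfSimilar
import HarnessLib

/-!
# Crux `ForcedSymmetry` (stmt-NavierStokesRegularity-4052), line `closing-dichotomy` — the sorry-free glue of the skeleton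

Support file (`--supports stmt-NavierStokesRegularity-4052`, registered sub-goal `orbitDichotomy`; lead c9).  The three
glue lemmas of the registered skeleton `Cruxes/ForcedSymmetry/Lines/closing_dichotomy.lean` (gen c9.2), made importable so
that the composition of the line can be landed with its research stubs as hypotheses (split/no-slack certificate,
`…ClosingDichotomySplit.lean`) and so that a planner can `--split` the crux along them (census v3 §R9):

* `orbitDichotomy` — the pointwise Auslander–Yorke / Akin–Auslander–Berg cut for the Navier–Stokes scaling flow
  `σ ↦ u_{e^σ}` in `L³_loc({t ≤ 0} × EuclideanSpace ℝ (Fin 3))`: a uniformly scaling-recurrent field is EITHER almost periodic along its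
  orbit OR orbit-sensitive at itself.  Pure logic over the two clauses (equicontinuity point + relatively dense
  returns ⇒ almost periods of the whole orbit).
* `rdss_vanishes_of_not_singular` — an origin-centred RDSS classical profile that is regular at the origin vanishes on
  `t < 0` (iterate `‖w‖_{L^∞(Q(0,r))} = l ‖w‖_{L^∞(Q(0,lr))}`).
* `accumulation_endpoint` — a slab profile with `‖u‖_{L³(Q(0,1))} ≤ 1/(n+1)` for all `n` is not backward-singular at
  the origin (the `AccumulationKill` endpoint of crux 1589's card `pesin-closing-hyperbolic-hulls`).

## References

* J. Auslander, J. Yorke, Tôhoku Math. J. 32 (1980) 177–188, doi:10.2748/tmj/1178229634. [AuslanderYorke1980]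
* E. Akin, J. Auslander, K. Berg, *When is a transitive map chaotic?*, Ohio State Univ. Math. Res. Inst. Publ. 5 (1996). [AkinAuslanderBerg1996]
* D. Chae, J. Wolf, arXiv:1610.09464, proof of Thm 1.3. [ChaeWolf2017RemovingDSS]
* D. Albritton, T. Barker, J. Math. Fluid Mech. 21 (2019), §3. [AlbrittonBarker2019]
-/

noncomputable section

-- the sub-problem namespace repeats the summit name (D-0017 layout `Summit.<S>.<P>.Theorems`)
set_option linter.dupNamespace false

open MeasureTheory Set Filter Topology Function

namespace Summit.NavierStokesRegularity.NavierStokesRegularity.Theorems.SymmetryModuliCountForcedSymmetry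

open Literature.Analysis.FluidPDE Metric
open scoped ENNReal

/-- **The orbit dichotomy (pointwise Auslander–Yorke / Akin–Auslander–Berg cut; glue of line `closing-dichotomy`, gen c9.1).**
A field `u` that is uniformly recurrent under the scaling flow in `L³_loc({t ≤ 0} × EuclideanSpace ℝ (Fin 3))` is EITHER almost periodic
ALONG ITS ORBIT (for every `ε`, compact `K`: relatively dense log-scales `σ` with
`sup_s ‖(u_{e^s})_{e^σ} − u_{e^s}‖_{L³(K)} ≤ ε`) OR orbit-sensitive at itself (some `δ > 0` and compact `K₁`: every
`L³_loc`-neighbourhood of `u` contains an orbit point `u_{e^σ}` and a log-time `s` with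
`‖(u_{e^s})_{e^σ} − u_{e^s}‖_{L³(K₁)} > δ`).  Proof: if `u` is not orbit-sensitive it is an equicontinuity point of the
scaling flow restricted to its orbit — for every target accuracy `(δ, K₁)` some source neighbourhood `(ε, K)` is mapped
`δ`-close along the whole orbit — and the `ε`-returns of `u` to that neighbourhood, relatively dense by uniform
recurrence, are then `δ`-almost periods of the entire orbit on `K₁`.  Pure logic over the two clauses; no measure
theory and no Navier–Stokes input (the content of Auslander–Yorke — uniformity over a minimal set — is not needed
pointwise). [cite: AuslanderYorke1980, Thm 1 (pointwise half); Furstenberg1981, Ch. 1 §4] -/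
theorem orbitDichotomy :
    ∀ (u : ℝ → EuclideanSpace ℝ (Fin 3) → EuclideanSpace ℝ (Fin 3)),
      (∀ ε : ℝ, 0 < ε → ∀ K : Set (ℝ × EuclideanSpace ℝ (Fin 3)), IsCompact K → K ⊆ Set.Iic (0 : ℝ) ×ˢ Set.univ →
        ∃ L : ℝ, 0 < L ∧ ∀ a : ℝ, ∃ σ ∈ Set.Icc a (a + L),
          eLpNorm (fun z : ℝ × EuclideanSpace ℝ (Fin 3) => nsRescale (Real.exp σ) u z.1 z.2 - u z.1 z.2) 3
            (volume.restrict K) ≤ ENNReal.ofReal ε) →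
      (∀ ε : ℝ, 0 < ε → ∀ K : Set (ℝ × EuclideanSpace ℝ (Fin 3)), IsCompact K → K ⊆ Set.Iic (0 : ℝ) ×ˢ Set.univ →
        ∃ L : ℝ, 0 < L ∧ ∀ a : ℝ, ∃ σ ∈ Set.Icc a (a + L), ∀ s : ℝ,
          eLpNorm (fun z : ℝ × EuclideanSpace ℝ (Fin 3) =>
              nsRescale (Real.exp σ) (nsRescale (Real.exp s) u) z.1 z.2 - nsRescale (Real.exp s) u z.1 z.2) 3
            (volume.restrict K) ≤ ENNReal.ofReal ε) ∨
      (∃ δ : ℝ, 0 < δ ∧ ∃ K₁ : Set (ℝ × EuclideanSpace ℝ (Fin 3)), IsCompact K₁ ∧ K₁ ⊆ Set.Iic (0 : ℝ) ×ˢ Set.univ ∧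
        ∀ ε : ℝ, 0 < ε → ∀ K : Set (ℝ × EuclideanSpace ℝ (Fin 3)), IsCompact K → K ⊆ Set.Iic (0 : ℝ) ×ˢ Set.univ →
          ∃ σ : ℝ, eLpNorm (fun z : ℝ × EuclideanSpace ℝ (Fin 3) => nsRescale (Real.exp σ) u z.1 z.2 - u z.1 z.2) 3
              (volume.restrict K) ≤ ENNReal.ofReal ε ∧
            ∃ s : ℝ, ENNReal.ofReal δ < eLpNorm (fun z : ℝ × EuclideanSpace ℝ (Fin 3) =>
                nsRescale (Real.exp σ) (nsRescale (Real.exp s) u) z.1 z.2 - nsRescale (Real.exp s) u z.1 z.2) 3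
              (volume.restrict K₁)) := by
  intro u hrec
  by_cases hsens : ∃ δ : ℝ, 0 < δ ∧ ∃ K₁ : Set (ℝ × EuclideanSpace ℝ (Fin 3)), IsCompact K₁ ∧ K₁ ⊆ Set.Iic (0 : ℝ) ×ˢ Set.univ ∧
      ∀ ε : ℝ, 0 < ε → ∀ K : Set (ℝ × EuclideanSpace ℝ (Fin 3)), IsCompact K → K ⊆ Set.Iic (0 : ℝ) ×ˢ Set.univ →
        ∃ σ : ℝ, eLpNorm (fun z : ℝ × EuclideanSpace ℝ (Fin 3) => nsRescale (Real.exp σ) u z.1 z.2 - u z.1 z.2) 3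
            (volume.restrict K) ≤ ENNReal.ofReal ε ∧
          ∃ s : ℝ, ENNReal.ofReal δ < eLpNorm (fun z : ℝ × EuclideanSpace ℝ (Fin 3) =>
              nsRescale (Real.exp σ) (nsRescale (Real.exp s) u) z.1 z.2 - nsRescale (Real.exp s) u z.1 z.2) 3
            (volume.restrict K₁)
  · exact Or.inr hsens
  · refine Or.inl fun ε hε K hK hKH => ?_
    -- `u` is an equicontinuity point of the scaling flow on its orbit, at target accuracy `(ε, K)`
    have hequi : ∃ ε' : ℝ, 0 < ε' ∧ ∃ K' : Set (ℝ × EuclideanSpace ℝ (Fin 3)), IsCompact K' ∧ K' ⊆ Set.Iic (0 : ℝ) ×ˢ Set.univ ∧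
        ∀ σ : ℝ, eLpNorm (fun z : ℝ × EuclideanSpace ℝ (Fin 3) => nsRescale (Real.exp σ) u z.1 z.2 - u z.1 z.2) 3
            (volume.restrict K') ≤ ENNReal.ofReal ε' →
          ∀ s : ℝ, eLpNorm (fun z : ℝ × EuclideanSpace ℝ (Fin 3) =>
              nsRescale (Real.exp σ) (nsRescale (Real.exp s) u) z.1 z.2 - nsRescale (Real.exp s) u z.1 z.2) 3
            (volume.restrict K) ≤ ENNReal.ofReal ε := by
      by_contra hne
      push Not at hne
      apply hsens
      refine ⟨ε, hε, K, hK, hKH, fun ε' hε' K' hK' hK'H => ?_⟩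
      obtain ⟨σ, hσ, s, hs⟩ := hne ε' hε' K' hK' hK'H
      exact ⟨σ, hσ, s, hs⟩
    obtain ⟨ε', hε', K', hK', hK'H, hball⟩ := hequi
    -- the `ε'`-returns of `u` to the source neighbourhood are relatively dense
    obtain ⟨L, hL, hret⟩ := hrec ε' hε' K' hK' hK'H
    refine ⟨L, hL, fun a => ?_⟩
    obtain ⟨σ, hσ, hclose⟩ := hret a
    exact ⟨σ, hσ, hball σ hclose⟩

/-- **An origin-centred RDSS classical profile that is regular at the origin vanishes on `t < 0`.**
Pointwise invariance (`rdssInvariant_pointwise_of_classical`) transports `L^∞` norms of final-slice cylinders: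
`‖w‖_{L^∞(Q(0,r))} = l · ‖w‖_{L^∞(Q(0, l r))}` (`eLpNorm_top_parabolicCylinder_rdss`); with `Q(0,r) ⊆ Q(0,lr)` and `l > 1`
a finite norm must vanish, and then it vanishes on every `Q(0, lᵏ r)`, i.e. `w = 0` a.e. on the slab, hence everywhere
on `t < 0` by continuity. [cite: ChaeWolf2017RemovingDSS, proof of Thm 1.3] -/
theorem rdss_vanishes_of_not_singular
    {w : ℝ → EuclideanSpace ℝ (Fin 3) → EuclideanSpace ℝ (Fin 3)} {q : ℝ → EuclideanSpace ℝ (Fin 3) → ℝ} {l : ℝ} {R : EuclideanSpace ℝ (Fin 3) ≃ₗᵢ[ℝ] EuclideanSpace ℝ (Fin 3)}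
    (hcl : IsClassicalNSSolutionOn (Set.Iio 0) 1 0 w q) (hl : 1 < l)
    (hae : (fun z : ℝ × EuclideanSpace ℝ (Fin 3) => l • R.symm (w (l ^ 2 * z.1) (l • R z.2)))
      =ᵐ[volume.restrict (Set.Iio (0 : ℝ) ×ˢ Set.univ)] (fun z : ℝ × EuclideanSpace ℝ (Fin 3) => w z.1 z.2))
    (hreg : ¬ IsBackwardSingularPoint w 0) :
    ∀ t < (0 : ℝ), ∀ x : EuclideanSpace ℝ (Fin 3), w t x = 0 := by
  have hl0 : 0 < l := lt_trans zero_lt_one hl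
  -- pointwise invariance on the open slab
  have hae' : (fun z : ℝ × EuclideanSpace ℝ (Fin 3) => l • R.symm (w (l ^ 2 * z.1 + 0) (l • R z.2 + 0)))
      =ᵐ[volume.restrict (Set.Iio (0 : ℝ) ×ˢ Set.univ)] (fun z : ℝ × EuclideanSpace ℝ (Fin 3) => w z.1 z.2) := by
    simpa only [add_zero] using hae
  have hpt := Summit.NavierStokesRegularity.NavierStokesRegularity.Theorems.SymmetryModuliCountForcedSymmetry.rdssInvariant_pointwise_of_classical
    R 0 hcl hl0 le_rfl hae'
  have hinv : ∀ t < (0 : ℝ), ∀ x : EuclideanSpace ℝ (Fin 3), l • R.symm (w (l ^ 2 * t) (l • R x + 0)) = w t x := by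
    intro t ht x
    simpa only [add_zero] using hpt t ht x
  -- the `L^∞` norms of the origin cylinders
  set N : ℝ → ℝ≥0∞ := fun r => eLpNorm (uncurry w) ∞ (volume.restrict (parabolicCylinder r (0 : ℝ × EuclideanSpace ℝ (Fin 3)))) with hN
  have hscale : ∀ r : ℝ, N r = ENNReal.ofReal l * N (l * r) := by
    intro r
    have key := Summit.NavierStokesRegularity.NavierStokesRegularity.Theorems.SymmetryModuliCountForcedSymmetry.eLpNorm_top_parabolicCylinder_rdss
      R 0 hl0 hinv r 0
    have hc : (((0 : ℝ), l • R (0 : EuclideanSpace ℝ (Fin 3)) + 0) : ℝ × EuclideanSpace ℝ (Fin 3)) = (0 : ℝ × EuclideanSpace ℝ (Fin 3)) := by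
      rw [map_zero, smul_zero, add_zero]; rfl
    have hc0 : (((0 : ℝ), (0 : EuclideanSpace ℝ (Fin 3))) : ℝ × EuclideanSpace ℝ (Fin 3)) = (0 : ℝ × EuclideanSpace ℝ (Fin 3)) := rfl
    rw [hc, hc0] at key
    simpa [hN] using key
  have hl1 : (1 : ℝ≥0∞) < ENNReal.ofReal l := ENNReal.one_lt_ofReal.2 hl
  have hlne : ENNReal.ofReal l ≠ 0 := (lt_trans zero_lt_one hl1).ne'
  -- a finite norm on one cylinder
  obtain ⟨r₀, hr₀, hfin⟩ : ∃ r₀ : ℝ, 0 < r₀ ∧ N r₀ ≠ ∞ := by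
    by_contra h
    push Not at h
    exact hreg fun r hr => h r hr
  -- it vanishes: `N r₀ ≤ N (l r₀) = N r₀ / l`
  have hmono : N r₀ ≤ N (l * r₀) := by
    refine eLpNorm_mono_measure _ (Measure.restrict_mono ?_ le_rfl)
    exact parabolicCylinder_mono hr₀.le (by nlinarith) _
  have hzero₀ : N r₀ = 0 := by
    by_contra hne
    have h1 : ENNReal.ofReal l * N r₀ ≤ 1 * N r₀ := by
      calc ENNReal.ofReal l * N r₀ ≤ ENNReal.ofReal l * N (l * r₀) := by gcongr
        _ = N r₀ := (hscale r₀).symm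
        _ = 1 * N r₀ := (one_mul _).symm
    have h2 : ENNReal.ofReal l ≤ 1 := (ENNReal.mul_le_mul_iff_left hne hfin).1 h1
    exact absurd h2 (not_le.2 hl1)
  -- hence on every `Q(0, lᵏ r₀)`
  have hzero : ∀ k : ℕ, N (l ^ k * r₀) = 0 := by
    intro k
    induction k with
    | zero => simpa using hzero₀
    | succ k ih =>
      have h := hscale (l ^ k * r₀)
      rw [ih] at h
      have h' : ENNReal.ofReal l * N (l * (l ^ k * r₀)) = 0 := h.symm
      rcases mul_eq_zero.1 h' with h'' | h''
      · exact absurd h'' hlne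
      · simpa [pow_succ, mul_comm, mul_assoc, mul_left_comm] using h''
  -- `w = 0` a.e. on each such cylinder, hence pointwise there (continuity on the open slab)
  have hwc : ContinuousOn (uncurry w) (Set.Iio (0 : ℝ) ×ˢ (Set.univ : Set (EuclideanSpace ℝ (Fin 3)))) := hcl.smooth_velocity.continuousOn
  have hvan : ∀ k : ℕ, ∀ z ∈ parabolicCylinder (l ^ k * r₀) (0 : ℝ × EuclideanSpace ℝ (Fin 3)), uncurry w z = 0 := by
    intro k
    have hQsub : parabolicCylinder (l ^ k * r₀) (0 : ℝ × EuclideanSpace ℝ (Fin 3)) ⊆ Set.Iio (0 : ℝ) ×ˢ (Set.univ : Set (EuclideanSpace ℝ (Fin 3))) :=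
      parabolicCylinder_origin_subset_slab _
    have hae0 : uncurry w =ᵐ[volume.restrict (parabolicCylinder (l ^ k * r₀) (0 : ℝ × EuclideanSpace ℝ (Fin 3)))] (fun _ => (0 : EuclideanSpace ℝ (Fin 3))) := by
      have h1 := ENNReal.ae_le_essSup (μ := volume.restrict (parabolicCylinder (l ^ k * r₀) (0 : ℝ × EuclideanSpace ℝ (Fin 3))))
        (fun z => ‖uncurry w z‖ₑ)
      have h2 : essSup (fun z => ‖uncurry w z‖ₑ) (volume.restrict (parabolicCylinder (l ^ k * r₀) (0 : ℝ × EuclideanSpace ℝ (Fin 3)))) = 0 := by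
        have := hzero k
        simpa [hN, eLpNorm_exponent_top, eLpNormEssSup] using this
      filter_upwards [h1] with z hz
      rw [h2] at hz
      simpa using hz
    have heq := Measure.eqOn_open_of_ae_eq hae0 (isOpen_parabolicCylinder _ _) (hwc.mono hQsub) continuousOn_const
    intro z hz
    exact heq hz
  -- every point of the open slab lies in some `Q(0, lᵏ r₀)`
  intro t ht x
  obtain ⟨k, hk⟩ : ∃ k : ℕ, Real.sqrt (-t) + ‖x‖ + 1 ≤ l ^ k * r₀ := by
    have htend : Tendsto (fun k : ℕ => l ^ k * r₀) atTop atTop :=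
      (tendsto_pow_atTop_atTop_of_one_lt hl).atTop_mul_const hr₀
    exact (htend.eventually_ge_atTop _).exists
  have hmem : ((t, x) : ℝ × EuclideanSpace ℝ (Fin 3)) ∈ parabolicCylinder (l ^ k * r₀) (0 : ℝ × EuclideanSpace ℝ (Fin 3)) := by
    rw [mem_parabolicCylinder]
    have hs : 0 ≤ Real.sqrt (-t) := Real.sqrt_nonneg _
    have hxn : 0 ≤ ‖x‖ := norm_nonneg _
    have hsq : Real.sqrt (-t) ^ 2 = -t := Real.sq_sqrt (by linarith)
    refine ⟨⟨?_, by simpa using ht⟩, ?_⟩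
    · have h1 : Real.sqrt (-t) < l ^ k * r₀ := by linarith
      have h2 : Real.sqrt (-t) ^ 2 < (l ^ k * r₀) ^ 2 := by
        exact pow_lt_pow_left₀ h1 hs (by norm_num)
      simp only [Prod.fst_zero]
      linarith
    · simpa [dist_zero_right] using (show ‖x‖ < l ^ k * r₀ by linarith)
  exact hvan k (t, x) hmem

/-- **The accumulation endpoint** (the `AccumulationKill` of crux 1589's card `pesin-closing-hyperbolic-hulls`, here a
theorem): a slab profile with `‖u‖_{L³(Q(0,1))} ≤ 1/(n+1)` for every `n` is not backward-singular at the origin (`u = 0`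
a.e. on `Q(0,1)`, so its `L^∞(Q(0,1))` norm is `0 ≠ ∞`; measurability from `memLp_three_of_slabProfile`). [folklore] -/
theorem accumulation_endpoint
    {u : ℝ → EuclideanSpace ℝ (Fin 3) → EuclideanSpace ℝ (Fin 3)} {p : ℝ → EuclideanSpace ℝ (Fin 3) → ℝ} {G : ℝ → EuclideanSpace ℝ (Fin 3) → EuclideanSpace ℝ (Fin 3) →L[ℝ] EuclideanSpace ℝ (Fin 3)}
    (hwg : HasWeakSpatialGradientOn (slab (EuclideanSpace ℝ (Fin 3)) (Set.Iio 0) isOpen_Iio) u G)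
    (hI : typeIBound (Set.Iio (0 : ℝ) ×ˢ Set.univ) u p G < ⊤)
    (hacc : ∀ n : ℕ, eLpNorm (fun z : ℝ × EuclideanSpace ℝ (Fin 3) => u z.1 z.2) 3
      (volume.restrict (parabolicCylinder 1 (0 : ℝ × EuclideanSpace ℝ (Fin 3)))) ≤ ENNReal.ofReal (1 / ((n : ℝ) + 1))) :
    ¬ IsBackwardSingularPoint u 0 := by
  set μ : Measure (ℝ × EuclideanSpace ℝ (Fin 3)) := volume.restrict (parabolicCylinder 1 (0 : ℝ × EuclideanSpace ℝ (Fin 3))) with hμ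
  have hmeas : AEStronglyMeasurable (uncurry u) μ :=
    (Summit.NavierStokesRegularity.NavierStokesRegularity.Theorems.memLp_three_of_slabProfile hwg hI one_pos).1
  have hlim : Tendsto (fun n : ℕ => ENNReal.ofReal (1 / ((n : ℝ) + 1))) atTop (𝓝 0) := by
    have h := ENNReal.tendsto_ofReal (tendsto_one_div_add_atTop_nhds_zero_nat)
    simpa using h
  have h0 : eLpNorm (uncurry u) 3 μ = 0 := by
    refine le_antisymm ?_ bot_le
    exact ge_of_tendsto' hlim fun n => hacc n
  have hae : uncurry u =ᵐ[μ] 0 := (eLpNorm_eq_zero_iff hmeas (by norm_num)).1 h0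
  intro hsing
  have h1 := hsing 1 one_pos
  have h2 : eLpNorm (uncurry u) ∞ μ = 0 := by
    rw [eLpNorm_congr_ae hae]
    exact eLpNorm_zero
  rw [h2] at h1
  exact ENNReal.zero_ne_top h1

end Summit.NavierStokesRegularity.NavierStokesRegularity.Theorems.SymmetryModuliCountForcedSymmetry

end
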